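import Literature.NumberTheory.EllipticCurves.ModularParametrizationScalingProofs
import Literature.NumberTheory.EllipticCurves.IwasawaSelmerIsTorsionProofs
import HarnessLib

/-!
# The Heegner module of a rescaled parametrisation: `ℋ̄_k([m]∘φ) = m • ℋ̄_k(φ)`, and
# `ℋ_∞([m]∘φ) = ℋ_∞(φ)`, `I(ℋ_∞)` unchanged, when `p ∤ m`

Sequel to `HeegnerFamilyScalingProofs` (the `Λ`-adic Heegner CLASS of the rescaled family is
`(C m) • 𝐳_∞`) and `ModularParametrizationScalingProofs` (the rescaled datum `Dt.zsmul m`, `[m] ∘ φ`,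
Manin-constant field `m · c`). Here the same bookkeeping is done for Perrin-Riou's / Howard's Heegner
MODULE `ℋ_∞ ⊆ 𝔖_p(K_∞)` (`heegnerModule`) and its characteristic ideal `I(ℋ_∞)` (`heegnerCharIdeal`),
the objects in which the Heegner point main conjecture is typed in the tree
(`CastellaGrossiSkinner2025.thmC_…`, `KellerYin2024.thmB_…_OPEN`, `BurungaleCastellaSkinner2025.thm122b_…`,
`BurungaleSkinnerTianWan2024.thm129_…_OPEN`):

* `HeegnerFamily.generators_zsmul`: the generators `y_K, z_0, …, z_k` of the rescaled family are
  `m •` those of `F`;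
* `heegnerModuleLayer_zsmul` (any `m`): `ℋ̄_k(m • F)` is the image of `ℋ̄_k(F)` under `m •` — Kummer
  families are additive (`IsKummerFamilyOver.zsmul`) and unique (`IsKummerFamilyOver.unique`), and
  the operators `padicPi c`, `conjPi σ` are additive;
* `WeierstrassCurve.zsmul_torsionH1Pi_injective_of_not_dvd`: for `p ∤ m`, multiplication by `m` is
  injective on `∏_k H¹(H, E[p^k])` (each factor is killed by `p^k`; Bézout);
* `isUnit_intCast_padicInt_iff`, `IwasawaAlgebra.isUnit_C_intCast_iff`,
  `IwasawaAlgebra.exists_unit_C_intCast`: `m`, resp. the constant `C m` of `Λ = ℤ_p⟦T⟧`, is a unit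
  iff `p ∤ m`;
* `heegnerModule_zsmul_of_not_dvd`: **`ℋ_∞(m • F) = ℋ_∞(F)` for `p ∤ m`** (`proj_k ((C m) • s) = m • proj_k s`
  by `proj_C`/`padicPi_intCast`, the two previous items, and `C m ∈ Λˣ`);
* `heegnerCharIdeal_zsmul_of_not_dvd`, `heegnerCharIdeal_zsmulSelf_of_not_dvd`: hence
  `I(ℋ_∞(m • F)) = I(ℋ_∞(F))`;
* `Module.charIdeal_quotient_span_C_smul_eq_of_not_dvd`: the one-class analogue
  `char(S/Λ((C m) • z)) = char(S/Λ z)` (`p ∤ m`), companion of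
  `Module.charIdeal_quotient_span_smul_eq` (`= (a) · char(S/Λz)` for a torsion-free `z`).

Reading (D-AUDIT-r19 ADDENDUM-8, cell `bsd-cited`): print normalises the Heegner class by a
parametrisation with `p`-adic-unit Manin constant (Perrin-Riou 1987, §1, Conj. B carries the factor
`c_π · u_K`; Burungale–Castella–Kim 2021, Remark after Conj. 1); inside that class of parametrisations
(`p ∤ m` relative to any member) the typed Heegner-point-main-conjecture conclusion does not depend
on the parametrisation — this file is the kernel form of that remark. What is NOT here: the
`m = p` companion `ℋ_∞(p • F) = p • ℋ_∞(F)` needs, beyond `heegnerModuleLayer_zsmul`, the identity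
`{s | proj_k s ∈ p • ℋ̄_k ∀k} = (C p) • {s | proj_k s ∈ ℋ̄_k ∀k}`, i.e. levelwise `p`-divisibility inside
`𝔖_p` — not attempted (the `𝐳_∞`-form refutation of the unpinned layout is
`KellerYin2024.false_of_thm521_OPEN_of_witness`).

## References
* [PerrinRiou1987BSMF] B. Perrin-Riou, *Fonctions L p-adiques, théorie d'Iwasawa et points de
  Heegner*, Bull. SMF 115 (1987), §1 p. 405 («un Λ-module H_∞ (dépendant du choix de la
  paramétrisation π de E)»), §3.4.
* [Howard2004HeegnerKolyvagin] B. Howard, *The Heegner point Kolyvagin system*, Compositio 140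
  (2004), §3.3 (`H_k`, `𝐇 = lim H_k`).
* [BurungaleCastellaKim2021] A. Burungale, F. Castella, C.-H. Kim, ANT 15 (2021), Remark after
  Conj. 1 (the factor `c_π · #𝒪_K^×/2`).
* [SilvermanAEC2009] J. Silverman, *AEC*, VIII.§2 (bilinearity of the Kummer pairing).
-/

open scoped Classical

open WeierstrassCurve Literature.NumberTheory.EllipticCurves
  Literature.NumberTheory.EllipticCurves.ModularForms

universe u

/-! ## §1 Arithmetic: units of `ℤ_p` and `Λ` among the integers; `m •` on `p^k`-torsion -/

namespace Literature.NumberTheory.EllipticCurves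

section Arith

variable {p : ℕ} [Fact p.Prime]

/-- An integer is a unit of `ℤ_p` iff it is prime to `p` (`‖m‖ = 1 ↔ ¬ ‖m‖ < 1 ↔ p ∤ m`).
[cite: Serre1973, Ch. II §1.2 Prop. 2 (a) (an element of ℤ_p is invertible iff it is not divisible by p)] -/
theorem isUnit_intCast_padicInt_iff (m : ℤ) : IsUnit ((m : ℤ) : ℤ_[p]) ↔ ¬ (p : ℤ) ∣ m := by
  rw [PadicInt.isUnit_iff, ← PadicInt.norm_int_lt_one_iff_dvd, not_lt]
  exact ⟨fun h ↦ h.ge, fun h ↦ le_antisymm (PadicInt.norm_le_one _) h⟩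

namespace IwasawaAlgebra

/-- The constant `C m ∈ Λ = ℤ_p⟦T⟧`, `m ∈ ℤ`, is a unit iff `p ∤ m` (a power series is a unit iff its
constant coefficient is, Mathlib `PowerSeries.isUnit_iff_constantCoeff`; units of `ℤ_p` = elements
prime to `p`). [cite: Serre1973, Ch. II §1.2 Prop. 2 (a) (an element of ℤ_p is invertible iff it is not divisible by p)] -/
theorem isUnit_C_intCast_iff (m : ℤ) :
    IsUnit (PowerSeries.C ((m : ℤ) : ℤ_[p]) : IwasawaAlgebra p) ↔ ¬ (p : ℤ) ∣ m := by
  rw [PowerSeries.isUnit_iff_constantCoeff, PowerSeries.constantCoeff_C]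
  exact isUnit_intCast_padicInt_iff m

/-- For `p ∤ m` the constant `C m` is a unit of `Λ` whose inverse is again a constant `C a` with
`a · m = 1` in `ℤ_p` (so that `proj_C` applies to both). [cite: Serre1973, Ch. II §1.2 Prop. 2 (a) (units of ℤ_p)] -/
theorem exists_unit_C_intCast {m : ℤ} (hm : ¬ (p : ℤ) ∣ m) :
    ∃ u : (IwasawaAlgebra p)ˣ, (u : IwasawaAlgebra p) = PowerSeries.C ((m : ℤ) : ℤ_[p]) ∧
      ∃ a : ℤ_[p], (↑u⁻¹ : IwasawaAlgebra p) = PowerSeries.C a ∧ a * (m : ℤ_[p]) = 1 := by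
  obtain ⟨am, ham⟩ := (isUnit_intCast_padicInt_iff (p := p) m).mpr hm
  refine ⟨⟨PowerSeries.C (am : ℤ_[p]), PowerSeries.C (↑am⁻¹ : ℤ_[p]), ?_, ?_⟩, ?_, ↑am⁻¹, rfl, ?_⟩
  · rw [← map_mul, Units.mul_inv, map_one]
  · rw [← map_mul, Units.inv_mul, map_one]
  · simp only [ham]
  · rw [← ham, Units.inv_mul]

end IwasawaAlgebra

end Arith

end Literature.NumberTheory.EllipticCurves

namespace WeierstrassCurve

variable {K : Type u} [Field K] (W : WeierstrassCurve K) (p : ℕ) [Fact p.Prime]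
  (H : Subgroup (Field.absoluteGaloisGroup K))

/-- **For `p ∤ m`, multiplication by `m` is injective on `∏_k H¹(H, E[p^k])`**: the `k`-th factor is
killed by `p^k` (`pow_smul_torsionH1Over_eq_zero`) and `a m + b p^k = 1` (Bézout), i.e. `m` is invertible in
`ℤ/p^k`. [cite: Serre1973, Ch. II §1.2 Prop. 2 (a) (an element of A_n = ℤ/p^nℤ is invertible iff it is not divisible by p)] -/
theorem zsmul_torsionH1Pi_injective_of_not_dvd {m : ℤ} (hm : ¬ (p : ℤ) ∣ m) :
    Function.Injective fun y : W.torsionH1Pi p H ↦ m • y := by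
  intro y y' h
  rw [← sub_eq_zero]
  have h0 : m • (y - y') = 0 := by
    have h' : m • y = m • y' := h
    rw [zsmul_sub, h', sub_self]
  funext k
  have hcop : IsCoprime m ((p : ℤ) ^ k) :=
    (((Nat.prime_iff_prime_int.mp (Fact.out : p.Prime)).coprime_iff_not_dvd).mpr hm).symm.pow_right
  obtain ⟨a, b, hab⟩ := hcop
  have hk : m • (y - y') k = 0 := by
    have := congrFun h0 k
    simpa using this
  have hpk : ((p : ℤ) ^ k) • (y - y') k = 0 := W.pow_smul_torsionH1Over_eq_zero H p k _
  calc (y - y') k = (a * m + b * (p : ℤ) ^ k) • (y - y') k := by rw [hab, one_smul]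
    _ = 0 := by rw [add_zsmul, mul_zsmul, mul_zsmul, hk, hpk, zsmul_zero, zsmul_zero, add_zero]

end WeierstrassCurve

namespace Literature.NumberTheory.EllipticCurves

/-! ## §2 One class: `Λ · ((C m) • z) = Λ · z` for `p ∤ m` -/

namespace Module

variable {p : ℕ} [Fact p.Prime]

/-- `Λ · ((C m) • z) = Λ · z` for `p ∤ m` (a unit rescaling does not move the line; Mathlib
`Submodule.span_singleton_smul_eq`). [cite: Serre1973, Ch. II §1.2 Prop. 2 (a) (p ∤ m ⇒ m is a unit of ℤ_p, hence C m of Λ)] -/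
theorem span_C_smul_eq_of_not_dvd {S : Type*} [AddCommGroup S]
    [_root_.Module (IwasawaAlgebra p) S] {m : ℤ} (hm : ¬ (p : ℤ) ∣ m) (z : S) :
    Submodule.span (IwasawaAlgebra p) {(PowerSeries.C ((m : ℤ) : ℤ_[p]) : IwasawaAlgebra p) • z} =
      Submodule.span (IwasawaAlgebra p) {z} :=
  Submodule.span_singleton_smul_eq ((IwasawaAlgebra.isUnit_C_intCast_iff m).mpr hm) z

/-- **`char(S/Λ((C m) • z)) = char(S/Λ z)` for `p ∤ m`** — companion of
`Module.charIdeal_quotient_span_smul_eq` (`char(S/Λ(a • z)) = (a) · char(S/Λ z)` for `z`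
torsion-free, which for `a = C p` is a strictly smaller ideal); the quotients by equal submodules are
isomorphic (`Module.charIdeal_eq_of_linearEquiv`). [cite: Serre1973, Ch. II §1.2 Prop. 2 (a) (p ∤ m ⇒ m ∈ ℤ_p^×)] -/
theorem charIdeal_quotient_span_C_smul_eq_of_not_dvd {S : Type*} [AddCommGroup S]
    [_root_.Module (IwasawaAlgebra p) S] {m : ℤ} (hm : ¬ (p : ℤ) ∣ m) (z : S) :
    charIdeal (IwasawaAlgebra p)
        (S ⧸ Submodule.span (IwasawaAlgebra p)
          {(PowerSeries.C ((m : ℤ) : ℤ_[p]) : IwasawaAlgebra p) • z}) =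
      charIdeal (IwasawaAlgebra p) (S ⧸ Submodule.span (IwasawaAlgebra p) {z}) :=
  Module.charIdeal_eq_of_linearEquiv (Submodule.quotEquivOfEq _ _ (span_C_smul_eq_of_not_dvd hm z))

end Module

/-! ## §3 The Heegner module of the rescaled family -/

section HeegnerModuleScaling

variable {K : Type u} [Field K] [NumberField K] {N : ℕ} [NeZero N] {W : WeierstrassCurve ℚ}
  {p : ℕ} [Fact p.Prime] {κ : ZpExtension K p} {γ : Field.absoluteGaloisGroup K}
  {jbar : AlgebraicClosure K →+* ℂ}

/-- **The generators of the rescaled family visible at layer `k` are `m •` those of `F`**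
(`y_K ↦ m • y_K`, `z_j ↦ m • z_j`). [cite: Howard2004HeegnerKolyvagin, §3.3 (the generators y_K, z_0, …, z_k of H_k)] -/
theorem HeegnerFamily.generators_zsmul (F : HeegnerFamily N W K κ jbar)
    (Dt' : ModularParametrizationData W N) (m : ℤ) (hφ : ∀ τ, Dt'.φ τ = m • F.Dt.φ τ) (k : ℕ) :
    (F.zsmul Dt' m hφ).generators k = (fun w ↦ m • w) '' F.generators k := by
  simp only [HeegnerFamily.generators, Set.image_union, Set.image_singleton, Set.image_image]
  rfl

/-- **`ℋ̄_k(m • F) = m • ℋ̄_k(F)`** (any `m ∈ ℤ`): the layer-`k` Heegner module of the rescaled family is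
the image of `ℋ̄_k(F)` under multiplication by `m` — the generating Kummer images scale, because
Kummer families are additive (`IsKummerFamilyOver.zsmul`) and unique (`IsKummerFamilyOver.unique`)
and `padicPi c`, `conjPi σ` are additive. [cite: Howard2004HeegnerKolyvagin, §3.3 (H_k is generated over ℤ_p[Gal(K_k/K)] by the Kummer images of y_K, z_0, …, z_k)] [cite: SilvermanAEC2009, VIII.§2 (the Kummer pairing is bilinear)] -/
theorem heegnerModuleLayer_zsmul [W.IsElliptic] (F : HeegnerFamily N W K κ jbar)
    (Dt' : ModularParametrizationData W N) (m : ℤ) (hφ : ∀ τ, Dt'.φ τ = m • F.Dt.φ τ) (k : ℕ) :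
    heegnerModuleLayer γ (F.zsmul Dt' m hφ) k =
      (heegnerModuleLayer γ F k).map (zsmulAddGroupHom m) := by
  apply le_antisymm
  · -- generators of the rescaled layer are `m •` generators of the layer
    refine (AddSubgroup.closure_le _).mpr ?_
    rintro v ⟨c, i, w', hw', d', hd', rfl⟩
    rw [HeegnerFamily.generators_zsmul] at hw'
    obtain ⟨w, hw, rfl⟩ := hw'
    have hfix : ∀ σ ∈ κ.layerSubgroup k, σ • w = w := fun σ hσ ↦ F.smul_eq_of_mem_generators hw hσ
    obtain ⟨d, hd⟩ := (W.baseChange K).exists_isKummerFamilyOver p (κ.layerSubgroup k) w hfix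
    have hd'K : (W.baseChange K).IsKummerFamilyOver p (κ.layerSubgroup k) (P := m • w)
        (fun σ hσ ↦ by rw [smul_zsmul_geomPoints, hfix σ hσ]) d' := fun n Q hQ ↦ hd' n Q hQ
    have hdd : d' = m • d := hd'K.unique p (hd.zsmul m)
    refine AddSubgroup.mem_map.mpr ⟨(W.baseChange K).padicPi p (κ.layerSubgroup k) c
      ((W.baseChange K).conjPi p (κ.layerSubgroup k) (γ ^ i) d), ?_, ?_⟩
    · exact AddSubgroup.subset_closure ⟨c, i, w, hw, d, fun n Q hQ ↦ hd n Q hQ, rfl⟩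
    · rw [zsmulAddGroupHom_apply, hdd, map_zsmul, map_zsmul]
  · -- `m •` generators of the layer are generators of the rescaled layer
    refine AddSubgroup.map_le_iff_le_comap.mpr ((AddSubgroup.closure_le _).mpr ?_)
    rintro v ⟨c, i, w, hw, d, hd, rfl⟩
    have hfix : ∀ σ ∈ κ.layerSubgroup k, σ • w = w := fun σ hσ ↦ F.smul_eq_of_mem_generators hw hσ
    have hdK : (W.baseChange K).IsKummerFamilyOver p (κ.layerSubgroup k) hfix d :=
      fun n Q hQ ↦ hd n Q hQ
    have hw' : m • w ∈ (F.zsmul Dt' m hφ).generators k := by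
      rw [HeegnerFamily.generators_zsmul]; exact Set.mem_image_of_mem _ hw
    refine AddSubgroup.mem_comap.mpr (AddSubgroup.subset_closure ⟨c, i, m • w, hw', m • d,
      fun n Q hQ ↦ (hdK.zsmul m) n Q hQ, ?_⟩)
    rw [zsmulAddGroupHom_apply, map_zsmul, map_zsmul]

/-- **`ℋ_∞(m • F) = ℋ_∞(F)` for `p ∤ m`**: the Heegner module of Perrin-Riou («dépendant du choix de la
paramétrisation π», §1 p. 405) does not change when the parametrisation is rescaled by an integer
prime to `p` — `proj_k ((C m) • s) = m • proj_k s` (`proj_C`, `padicPi_intCast`),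
`heegnerModuleLayer_zsmul`, injectivity of `m •` on `∏_k H¹(K_k, E[p^k])`, and `C m ∈ Λˣ`. Printed
form: the terms of the Heegner point main conjecture «are invariant under isogenies» once `p` is
inverted (CGLS22) — for the isogeny `[m]`, `p ∤ m`, already integrally. [cite: PerrinRiou1987BSMF, §1 p. 405 (H_∞ «dépendant du choix de la paramétrisation π»; Conj. B carries the factor c_π·u)] [cite: CastellaGrossiLeeSkinner2022, Remark after Conjecture A (Intro: the integral terms are not isogeny-invariant; with p inverted they are)] -/
theorem heegnerModule_zsmul_of_not_dvd [W.IsElliptic]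
    (D : (W.baseChange K).LambdaAdicSelmerData κ γ) (F : HeegnerFamily N W K κ jbar)
    (Dt' : ModularParametrizationData W N) {m : ℤ} (hm : ¬ (p : ℤ) ∣ m)
    (hφ : ∀ τ, Dt'.φ τ = m • F.Dt.φ τ) :
    heegnerModule D (F.zsmul Dt' m hφ) = heegnerModule D F := by
  obtain ⟨u, hu, a, -, -⟩ := IwasawaAlgebra.exists_unit_C_intCast (p := p) hm
  -- `proj k ((C m) • s) = m • proj k s`
  have hprojC : ∀ (k : ℕ) (s : D.S), D.proj k ((u : IwasawaAlgebra p) • s) = m • D.proj k s := by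
    intro k s
    rw [hu, D.proj_C, padicPi_intCast]
  apply le_antisymm
  · -- generators of `ℋ_∞(m • F)` lie in `ℋ_∞(F)`
    refine Submodule.span_le.mpr ?_
    intro s' hs'
    -- `t := u⁻¹ • s'` has its projections in the layers of `F`
    have ht : ∀ k, D.proj k ((↑u⁻¹ : IwasawaAlgebra p) • s') ∈ heegnerModuleLayer γ F k := by
      intro k
      have hk := hs' k
      rw [heegnerModuleLayer_zsmul, AddSubgroup.mem_map] at hk
      obtain ⟨ℓ, hℓ, hℓeq⟩ := hk
      rw [zsmulAddGroupHom_apply] at hℓeq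
      -- `m • proj k t = proj k s' = m • ℓ`, and `m •` is injective
      have hinj := (W.baseChange K).zsmul_torsionH1Pi_injective_of_not_dvd p (κ.layerSubgroup k) hm
      have hmt : m • D.proj k ((↑u⁻¹ : IwasawaAlgebra p) • s') = m • ℓ := by
        rw [← hprojC, ← mul_smul, Units.mul_inv, one_smul, hℓeq]
      rw [hinj hmt]
      exact hℓ
    have ht' : (↑u⁻¹ : IwasawaAlgebra p) • s' ∈ heegnerModule D F :=
      Submodule.subset_span ht
    have := (heegnerModule D F).smul_mem (u : IwasawaAlgebra p) ht'
    rwa [← mul_smul, Units.mul_inv, one_smul] at this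
  · -- generators of `ℋ_∞(F)` lie in `ℋ_∞(m • F)`
    refine Submodule.span_le.mpr ?_
    intro s hs
    have hus : ∀ k, D.proj k ((u : IwasawaAlgebra p) • s) ∈
        heegnerModuleLayer γ (F.zsmul Dt' m hφ) k := by
      intro k
      rw [hprojC, heegnerModuleLayer_zsmul]
      exact AddSubgroup.mem_map.mpr ⟨D.proj k s, hs k, (zsmulAddGroupHom_apply _ _)⟩
    have hus' : (u : IwasawaAlgebra p) • s ∈ heegnerModule D (F.zsmul Dt' m hφ) :=
      Submodule.subset_span hus
    have := (heegnerModule D (F.zsmul Dt' m hφ)).smul_mem (↑u⁻¹ : IwasawaAlgebra p) hus'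
    rwa [← mul_smul, Units.inv_mul, one_smul] at this

/-- **`I(ℋ_∞(m • F)) = I(ℋ_∞(F))` for `p ∤ m`**: the characteristic ideal of `𝔖/ℋ_∞`
(`heegnerCharIdeal`, Perrin-Riou's `I(H_∞)`) is invariant under the rescalings of the
parametrisation by integers prime to `p` — so the `heegnerCharIdeal`-form Heegner point main
conjecture statements of the tree do not depend on the parametrisation inside a class of
`p`-adic-unit Manin constant. [cite: PerrinRiou1987BSMF, §1 p. 405 (I(H_∞), «la série caractéristique du quotient de S_p(D_∞) par H_∞»; H_∞ depends on π)] [cite: BurungaleCastellaKim2021, Remark after Conj. 1 (Perrin-Riou's Conj. B carries c_π·#𝒪_K^×/2, dropped when a p-adic unit)] -/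
theorem heegnerCharIdeal_zsmul_of_not_dvd [W.IsElliptic]
    (D : (W.baseChange K).LambdaAdicSelmerData κ γ) (F : HeegnerFamily N W K κ jbar)
    (Dt' : ModularParametrizationData W N) {m : ℤ} (hm : ¬ (p : ℤ) ∣ m)
    (hφ : ∀ τ, Dt'.φ τ = m • F.Dt.φ τ) :
    heegnerCharIdeal D (F.zsmul Dt' m hφ) = heegnerCharIdeal D F :=
  Module.charIdeal_eq_of_linearEquiv
    (Submodule.quotEquivOfEq _ _ (heegnerModule_zsmul_of_not_dvd D F Dt' hm hφ))

/-- The same at the constructed rescaling `F.zsmulSelf m` (datum `F.Dt.zsmul m`, Manin-constant field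
`m · c`): if the rescaled datum's constant is prime to `p` then so is `m`, and `I(ℋ_∞)` is
unchanged. [cite: PerrinRiou1987BSMF, §1 pp. 404–405 (c_π; H_∞ depends on π)] [cite: BurungaleCastellaKim2021, Remark after Conj. 1 (the factor c_π)] -/
theorem heegnerCharIdeal_zsmulSelf_of_not_dvd [W.IsElliptic]
    (D : (W.baseChange K).LambdaAdicSelmerData κ γ) (F : HeegnerFamily N W K κ jbar)
    {m : ℤ} (hm0 : m ≠ 0) (hpin : ¬ (p : ℤ) ∣ (F.Dt.zsmul m hm0).c) :
    heegnerCharIdeal D (F.zsmulSelf m hm0) = heegnerCharIdeal D F := by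
  have hm : ¬ (p : ℤ) ∣ m := fun h ↦ hpin (by
    change (p : ℤ) ∣ m * F.Dt.c
    exact h.mul_right _)
  exact heegnerCharIdeal_zsmul_of_not_dvd D F (F.Dt.zsmul m hm0) hm (F.Dt.φ_zsmul hm0)

end HeegnerModuleScaling

end Literature.NumberTheory.EllipticCurves
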